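import Literature.NumberTheory.LFunctions.NymanBeurlingBaezDuarteProofs
import Summits.RiemannHypothesis.RiemannHypothesis.Theorems.NymanBeurlingMinimiser
import HarnessLib

/-!
# RH-EQUIVALENT·DERIVED — RiemannHypothesis / Nyman–Beurling: Báez-Duarte's criterion read on the DATA object,
`RH ⇔ d_N² = nbDistSq N (nbMinimiser N) → 0`; and (RH-FREE) the certified sequence `N ↦ d_N²` is non-increasing

Column LI/NB of the RH ladder, cell `pub/rh-li` (D-0040 frame «find criterion where an object would prove RH · provide
data · prove the results of the data»).  The CRITERION rung holds Báez-Duarte's theorem `baezDuarte_iff_holds` (tree,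
unconditional): `RH ⇔ ∀ ε > 0 ∃ N ∃ c, ‖χ − Σ_{k<N} c_k ρ_{k+1}‖_{L²(0,∞)} < ε`.  The DATA rung computes the minimiser
`c⋆_N = G⁻¹ b` and `d_N² = 1 − b·c⋆_N` (certified at every `N ≤ 10⁴`, DATA.md §L).  With `nbDistSq_nbMinimiser_le` (the
DATA object attains the infimum, `NymanBeurlingMinimiser.lean`) the criterion becomes a statement about that one sequence:

* `nbDistSq_nbMinimiser_succ_le`, `antitone_nbDistSq_nbMinimiser` (RH-FREE): `d_{N+1}² ≤ d_N²` (pad with a zero);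
* `Criterion.eLpNorm_approx_eq`: `‖χ − f_c‖_{L²(0,∞)} = √(d_N²(c))` (Bochner/`eLpNorm` dictionary);
* `riemannHypothesis_iff_tendsto_nbDistSq_nbMinimiser` (RH-EQUIVALENT·DERIVED):
  `RiemannHypothesis ↔ Tendsto (fun N ↦ nbDistSq N (nbMinimiser N)) atTop (𝓝 0)`;
* `riemannHypothesis_iff_forall_exists_nbDistSq_lt` (RH-EQUIVALENT·DERIVED): `RH ↔ ∀ ε > 0, ∃ N, d_N² < ε`.

WHAT THIS IS NOT: a re-indexing of a known RH-criterion onto the column's certified object — it fixes WHICH property of the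
data (`d_N² → 0`; conjecturally `d_N² ~ (2+γ−log 4π)/log N`, BDBLS) would be RH; it does not move RH, and no finite table of
`d_N²` (e.g. `d_N² log N ∈ [0.0451, 0.0458]` on `[5·10³, 10⁴]`) is evidence for it.  [rh-li-eng-3]  Nothing here bears on
the truth of RH.
-/

noncomputable section

-- D-0017: `Summit.<S>.<S>.…` is the designed namespace of a single-problem summit.
set_option linter.dupNamespace false

open MeasureTheory Set Finset
open scoped Matrix

namespace Summit.RiemannHypothesis.RiemannHypothesis.Theorems.NbTheory

open Literature.NumberTheory.LFunctions Literature.NumberTheory.LFunctions.BaezDuarteOnlyIf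
open GramPosDef Minimiser

namespace Criterion

/-! ## Monotonicity in `N`: a longer Dirichlet polynomial can only do better -/

/-- Padding a coefficient vector with a trailing `0` does not change the approximant. -/
lemma approx_snoc_zero {N : ℕ} (c : Fin N → ℝ) :
    approx (Fin.snoc c 0 : Fin (N + 1) → ℝ) = approx c := by
  funext x
  simp [approx, Fin.sum_univ_castSucc, Fin.snoc_castSucc, Fin.snoc_last]

/-- … nor the squared distance. -/
lemma nbDistSq_snoc_zero {N : ℕ} (c : Fin N → ℝ) :
    nbDistSq (N + 1) (Fin.snoc c 0 : Fin (N + 1) → ℝ) = nbDistSq N c := by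
  rw [nbDistSq_eq_integral, nbDistSq_eq_integral, approx_snoc_zero]

end Criterion

open Criterion

/-- **`d_{N+1}² ≤ d_N²` (RH-FREE).** -/
theorem nbDistSq_nbMinimiser_succ_le (N : ℕ) :
    nbDistSq (N + 1) (nbMinimiser (N + 1)) ≤ nbDistSq N (nbMinimiser N) :=
  (nbDistSq_nbMinimiser_le (Fin.snoc (nbMinimiser N) 0)).trans_eq (nbDistSq_snoc_zero _)

/-- **The certified sequence `N ↦ d_N²` is non-increasing (RH-FREE).** -/
theorem antitone_nbDistSq_nbMinimiser : Antitone fun N ↦ nbDistSq N (nbMinimiser N) :=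
  antitone_nat_of_succ_le nbDistSq_nbMinimiser_succ_le

namespace Criterion

/-! ## The `L²`-norm of the criterion is `√(d_N²(c))` -/

/-- `‖χ − Σ c_k ρ_{k+1}‖_{L²(0,∞)} = √(d_N²(c))` as an `eLpNorm` identity. -/
lemma eLpNorm_approx_eq {N : ℕ} (c : Fin N → ℝ) :
    eLpNorm (approx c) 2 (volume.restrict (Set.Ioi (0 : ℝ))) = ENNReal.ofReal (Real.sqrt (nbDistSq N c)) := by
  have hmem : MemLp (approx c) 2 (volume.restrict (Set.Ioi (0 : ℝ))) :=
    (memLp_two_iff_integrable_sq (measurable_approx c).aestronglyMeasurable).2 (integrableOn_sq_approx c)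
  rw [hmem.eLpNorm_eq_integral_rpow_norm two_ne_zero ENNReal.ofNat_ne_top, nbDistSq_eq_integral]
  congr 1
  simp only [ENNReal.toReal_ofNat, Real.rpow_two, Real.norm_eq_abs, sq_abs]
  rw [Real.sqrt_eq_rpow]
  norm_num

/-- `‖χ − Σ c_k ρ_{k+1}‖_{L²(0,∞)} < ε ⇔ d_N²(c) < ε²` (`ε > 0`). -/
lemma eLpNorm_approx_lt_iff {N : ℕ} (c : Fin N → ℝ) {ε : ℝ} (hε : 0 < ε) :
    eLpNorm (approx c) 2 (volume.restrict (Set.Ioi (0 : ℝ))) < ENNReal.ofReal ε ↔ nbDistSq N c < ε ^ 2 := by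
  rw [eLpNorm_approx_eq, ENNReal.ofReal_lt_ofReal_iff hε, Real.sqrt_lt' hε]

end Criterion

open Criterion Filter Topology

/-- **RH-EQUIVALENT·DERIVED — the DATA column's residual, by name.**  Báez-Duarte's criterion (tree theorem
`baezDuarte_iff_holds`: `RH ⇔ χ ∈ closure span{ρ_a}` in `L²(0,∞)`) read on the certified object of the DATA rung: the
Riemann Hypothesis holds iff the non-increasing sequence `d_N² = nbDistSq N (nbMinimiser N) = 1 − b·c⋆_N` tends to `0`.
This isolates WHICH property of the certified numbers (DATA.md §L: `d_N² log N ≈ 0.045` on `[5·10³, 10⁴]`) is RH; it is a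
re-indexing of the criterion, not progress toward RH, and no finite table bears on it. -/
theorem riemannHypothesis_iff_tendsto_nbDistSq_nbMinimiser :
    RiemannHypothesis ↔ Tendsto (fun N ↦ nbDistSq N (nbMinimiser N)) atTop (𝓝 0) := by
  have hBD : RiemannHypothesis ↔ ∀ ε : ℝ, 0 < ε → ∃ (N : ℕ) (c : Fin N → ℝ),
      eLpNorm (approx c) 2 (volume.restrict (Set.Ioi (0 : ℝ))) < ENNReal.ofReal ε := baezDuarte_iff_holds
  rw [hBD, Metric.tendsto_atTop]
  constructor
  · intro h ε hε
    obtain ⟨N, c, hc⟩ := h (Real.sqrt ε) (Real.sqrt_pos.2 hε)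
    rw [eLpNorm_approx_lt_iff c (Real.sqrt_pos.2 hε), Real.sq_sqrt hε.le] at hc
    refine ⟨N, fun n hn ↦ ?_⟩
    rw [Real.dist_eq, sub_zero, abs_of_pos (nbDistSq_pos _)]
    exact ((antitone_nbDistSq_nbMinimiser hn).trans (nbDistSq_nbMinimiser_le c)).trans_lt hc
  · intro h ε hε
    obtain ⟨N, hN⟩ := h (ε ^ 2) (by positivity)
    refine ⟨N, nbMinimiser N, ?_⟩
    have h1 := hN N le_rfl
    rw [Real.dist_eq, sub_zero, abs_of_pos (nbDistSq_pos _)] at h1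
    exact (eLpNorm_approx_lt_iff _ hε).2 h1

/-- **RH-EQUIVALENT·DERIVED, ε-form.**  `RH ⇔ ∀ ε > 0, ∃ N, d_N² < ε` (the sequence being non-increasing and positive). -/
theorem riemannHypothesis_iff_forall_exists_nbDistSq_lt :
    RiemannHypothesis ↔ ∀ ε : ℝ, 0 < ε → ∃ N : ℕ, nbDistSq N (nbMinimiser N) < ε := by
  rw [riemannHypothesis_iff_tendsto_nbDistSq_nbMinimiser, Metric.tendsto_atTop]
  refine ⟨fun h ε hε ↦ ?_, fun h ε hε ↦ ?_⟩
  · obtain ⟨N, hN⟩ := h ε hε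
    have h1 := hN N le_rfl
    rw [Real.dist_eq, sub_zero, abs_of_pos (nbDistSq_pos _)] at h1
    exact ⟨N, h1⟩
  · obtain ⟨N, hN⟩ := h ε hε
    refine ⟨N, fun n hn ↦ ?_⟩
    rw [Real.dist_eq, sub_zero, abs_of_pos (nbDistSq_pos _)]
    exact (antitone_nbDistSq_nbMinimiser hn).trans_lt hN

end Summit.RiemannHypothesis.RiemannHypothesis.Theorems.NbTheory

end
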